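import Summits.CriticalPhenomena.CardyFormulaZ2.Theorems.CardyUniqueLimitCardyRigidityMartingaleOfDataPath
import Literature.Probability.Process.StoppedClockContinuity
import Literature.Probability.RandomPlanarGeometry.LoewnerRealFlowDriverContinuity
import Literature.Probability.RandomPlanarGeometry.ObservableLimitPassageAE
import HarnessLib

/-!
# Joint continuity of the level-stopped crossing functional at paths with clean level exits (line `crossing-martingale`, crux `CardyRigidity`)

Third helper file of stub `stub_martingaleOfData` (passage of the crossing-martingale property to
a scaling limit; crux `CardyRigidity`, stmt-CriticalPhenomena-0746).  The a.e.-continuity input of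
the passage theorem `Loewner.integral_cylinder_eq_zero_of_discreteMartingales_of_ae_continuousAt`
for the clipped crossing functional of `…MartingaleOfDataPath.lean`:

* `continuousAt_crossingObs_of_clean` — for a driving process `W ξ = Φ ξ` read off a CONTINUOUS map
  `Φ : X → C([0,∞), ℝ)` of a topological space: if the path `W ξ₀` starts in the window and every
  coordinate of the level box (first-mark flow, the two gaps) attaining the level time of `ξ₀`
  exits cleanly, then `(u, ξ) ↦ crossingObs ĝ W x m M d u ξ` is jointly continuous at `(u₀, ξ₀)`
  for every `u₀`: the mark flows are jointly continuous in time and driving path away from the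
  driving point (`Loewner.continuousAt_realFlowStop_driver`), and the level time is the minimum of
  three exit times of uniformly close path functionals (`Process.lsc_exitTime_comp`,
  `Process.usc_exitTime_comp_of_clean`, `Process.continuousAt_stoppedClock_of_lsc_usc(_of_lt)`);
* `continuousAt_crossingObs_cutStart` — the clipped functional of the canonical process at a path
  started at `0` with clean level exits;
* `tendsto_measureReal_le_abs_start` — if continuous-path processes `V k` converge in distribution
  to a process started at `0`, then `P(δ ≤ |V k 0|) → 0` (almost-continuous mapping theorem for the
  indicator of the closed set `{δ ≤ |w 0|}`): the discrete paths not started in `(-δ, δ)` form a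
  vanishing bad event.
-/

noncomputable section

open MeasureTheory Filter Set Topology
open scoped NNReal ENNReal
open Literature.Probability.RandomPlanarGeometry
open Literature.Probability.Process

namespace Summit.CriticalPhenomena.CardyFormulaZ2.Cruxes.CardyRigidity.CrossingMartingale

namespace MartingaleOfData

variable {x : Fin 3 → ℝ} {m M d : ℝ}

/-! ### Joint continuity of the level-stopped crossing functional at a sample with clean level exits -/

/-- **Joint continuity of the level-stopped crossing observable** at `(u₀, ξ₀)`, for a driving
process `W ξ = Φ ξ` read off a continuous map `Φ` into driving-path space, a sample `ξ₀` whose path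
starts in the window `x₀ - M < W ξ₀ 0 < x₀ - m` and whose level time is either infinite, or finite
with EVERY coordinate of the level box exiting at the level time exiting cleanly (the first-mark
flow through `m` or `M`, a gap through `d`).  Continuous kernel, admissible data; every observation
time `u₀`. [cite: CamiaNewman2007, §5] -/
theorem continuousAt_crossingObs_of_clean {X : Type*} [TopologicalSpace X] {W : X → ℝ≥0 → ℝ}
    {Φ : X → C(ℝ≥0, ℝ)} (hΦ : Continuous Φ) (hWΦ : ∀ ξ, W ξ = Φ ξ)
    {ĝ : ℝ → ℝ} (hĝ : Continuous ĝ) (h : AdmissibleLevels x m M d)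
    {ξ₀ : X} (hξ₀ : W ξ₀ 0 ∈ Ioo (x 0 - M) (x 0 - m))
    (hclean₀ : ∀ T : ℝ≥0, levelTime W x m M d ξ₀ = T → exitTime (markFlow W (x 0)) m M ξ₀ = T →
      ∀ ε : ℝ, 0 < ε → ∃ s : ℝ≥0, T < s ∧ (s : ℝ) < T + ε ∧ markFlow W (x 0) s ξ₀ ∉ Icc m M)
    (hclean₁ : ∀ T : ℝ≥0, levelTime W x m M d ξ₀ = T →
      exitTime (fun t ξ ↦ markFlow W (x 1) t ξ - markFlow W (x 0) t ξ) d (x 2 - x 0 + 1) ξ₀ = T →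
      ∀ ε : ℝ, 0 < ε → ∃ s : ℝ≥0, T < s ∧ (s : ℝ) < T + ε ∧
        markFlow W (x 1) s ξ₀ - markFlow W (x 0) s ξ₀ ∉ Icc d (x 2 - x 0 + 1))
    (hclean₂ : ∀ T : ℝ≥0, levelTime W x m M d ξ₀ = T →
      exitTime (fun t ξ ↦ markFlow W (x 2) t ξ - markFlow W (x 1) t ξ) d (x 2 - x 0 + 1) ξ₀ = T →
      ∀ ε : ℝ, 0 < ε → ∃ s : ℝ≥0, T < s ∧ (s : ℝ) < T + ε ∧
        markFlow W (x 2) s ξ₀ - markFlow W (x 1) s ξ₀ ∉ Icc d (x 2 - x 0 + 1))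
    (u₀ : ℝ≥0) :
    ContinuousAt (fun q : ℝ≥0 × X ↦ crossingObs ĝ W x m M d q.1 q.2) (u₀, ξ₀) := by
  -- adapted from the checked scratch `Lines/crossing_martingale_MartingalePassageCombined.lean`
  have hmpos : (0 : ℝ) < m := h.m_pos
  have hc : ∀ ξ, Continuous (W ξ) := fun ξ ↦ by rw [hWΦ ξ]; exact (Φ ξ).continuous
  have hcont : ∀ ξ i, Continuous fun s ↦ markFlow W (x i) s ξ := fun ξ i ↦
    continuous_markFlow_pt (hc ξ) (x i)
  have hWf : ∀ (y : ℝ) (s : ℝ≥0) (ξ : X), markFlow W y s ξ = Loewner.realFlowStop (Φ ξ) y s :=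
    fun y s ξ ↦ by show Loewner.realFlowStop (W ξ) y s = _; rw [hWΦ ξ]
  -- the three coordinate path functionals and their exit times
  set Φ0 : X → C(ℝ≥0, ℝ) := fun ξ ↦ ⟨fun s ↦ markFlow W (x 0) s ξ, hcont ξ 0⟩ with hΦ0
  set Ψ1 : X → C(ℝ≥0, ℝ) := fun ξ ↦
    ⟨fun s ↦ markFlow W (x 1) s ξ - markFlow W (x 0) s ξ, (hcont ξ 1).sub (hcont ξ 0)⟩ with hΨ1
  set Ψ2 : X → C(ℝ≥0, ℝ) := fun ξ ↦
    ⟨fun s ↦ markFlow W (x 2) s ξ - markFlow W (x 1) s ξ, (hcont ξ 2).sub (hcont ξ 1)⟩ with hΨ2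
  set τ0 : X → WithTop ℝ≥0 := fun ξ ↦ exitTime (fun t (q : C(ℝ≥0, ℝ)) ↦ q t) m M (Φ0 ξ) with hτ0
  set τ1 : X → WithTop ℝ≥0 := fun ξ ↦
    exitTime (fun t (q : C(ℝ≥0, ℝ)) ↦ q t) d (x 2 - x 0 + 1) (Ψ1 ξ) with hτ1
  set τ2 : X → WithTop ℝ≥0 := fun ξ ↦
    exitTime (fun t (q : C(ℝ≥0, ℝ)) ↦ q t) d (x 2 - x 0 + 1) (Ψ2 ξ) with hτ2
  have hlevel : ∀ ξ, levelTime W x m M d ξ = min (τ0 ξ) (min (τ1 ξ) (τ2 ξ)) := fun ξ ↦ rfl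
  set ρ₀ : WithTop ℝ≥0 := levelTime W x m M d ξ₀ with hρ₀
  -- flows of `ξ₀` stay `≥ m` up to the level time
  have hbox : ∀ s : ℝ≥0, (s : WithTop ℝ≥0) ≤ ρ₀ → ∀ i, m ≤ markFlow W (x i) s ξ₀ := by
    intro s hs i
    obtain ⟨h0, h01, h12⟩ := marks_pos_pt (hc ξ₀) h hξ₀ hs
    obtain ⟨hX0, -, -⟩ := marks_mem_box_pt (hc ξ₀) h hξ₀ hs
    fin_cases i
    · exact hX0.1
    · show m ≤ markFlow W (x 1) s ξ₀
      linarith [hX0.1]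
    · show m ≤ markFlow W (x 2) s ξ₀
      linarith [hX0.1]
  -- Step 1: horizons `b < b'` and the margin `m/2` on `[0, b']`
  obtain ⟨b, b', hbb', hTb, hub, hmar⟩ : ∃ b b' : ℝ≥0, b < b' ∧
      (∀ T : ℝ≥0, ρ₀ = T → T < b) ∧ (ρ₀ = ⊤ → u₀ < b) ∧
      ∀ i, ∀ s : ℝ≥0, s ≤ b' → m / 2 ≤ markFlow W (x i) s ξ₀ := by
    induction hρ : ρ₀ with
    | top =>
      refine ⟨u₀ + 1, u₀ + 2, by
        rw [← NNReal.coe_lt_coe]; push_cast; linarith, fun T hT ↦ absurd hT WithTop.top_ne_coe,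
        fun _ ↦ by rw [← NNReal.coe_lt_coe]; push_cast; linarith, fun i s _ ↦ ?_⟩
      have := hbox s (by rw [hρ]; exact le_top) i
      linarith
    | coe T =>
      have hδ : ∀ i, ∃ δ > 0, ∀ s : ℝ≥0, dist s T < δ → m / 2 < markFlow W (x i) s ξ₀ := by
        intro i
        have hci := (hcont ξ₀ i).continuousAt (x := T)
        obtain ⟨δ, hδ, hball⟩ := Metric.continuousAt_iff.1 hci (m / 2) (by positivity)
        refine ⟨δ, hδ, fun s hs ↦ ?_⟩
        have h1 := hball hs
        rw [Real.dist_eq] at h1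
        have h2 := hbox T (by rw [hρ]) i
        have := (abs_sub_lt_iff.1 h1).2
        linarith
      choose δ hδpos hδ using hδ
      set δm : ℝ := min (δ 0) (min (δ 1) (δ 2)) with hδm
      have hδmpos : 0 < δm := lt_min (hδpos 0) (lt_min (hδpos 1) (hδpos 2))
      have hδle : ∀ i, δm ≤ δ i := by
        intro i; fin_cases i
        · exact min_le_left _ _
        · exact (min_le_right _ _).trans (min_le_left _ _)
        · exact (min_le_right _ _).trans (min_le_right _ _)
      refine ⟨⟨(T : ℝ) + δm / 4, by positivity⟩, ⟨(T : ℝ) + δm / 2, by positivity⟩, ?_, ?_, ?_, ?_⟩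
      · rw [← NNReal.coe_lt_coe]; show (T : ℝ) + δm / 4 < T + δm / 2; linarith
      · intro T' hT'
        have : T = T' := by exact_mod_cast hT'
        subst this
        rw [← NNReal.coe_lt_coe]; show (T : ℝ) < T + δm / 4; linarith
      · intro htop; exact absurd htop WithTop.coe_ne_top
      · intro i s hs
        have hs' : (s : ℝ) ≤ T + δm / 2 := by
          have := NNReal.coe_le_coe.2 hs; exact this
        rcases le_or_gt s T with hsT | hTs
        · have := hbox s (by rw [hρ]; exact WithTop.coe_le_coe.2 hsT) i
          linarith
        · refine (hδ i s ?_).le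
          rw [NNReal.dist_eq, abs_of_nonneg (by
            have := NNReal.coe_lt_coe.2 hTs; linarith)]
          have := NNReal.coe_lt_coe.2 hTs
          linarith [hδle i]
  -- Step 2: joint continuity of the flows in time and sample on `[0, b')`
  have hm₀ : (0 : ℝ≥0) < ⟨m / 2, by positivity⟩ := by
    rw [← NNReal.coe_lt_coe]; show (0 : ℝ) < m / 2; positivity
  have JF : ∀ i, ∀ s₀ : ℝ≥0, s₀ < b' →
      ContinuousAt (fun q : ℝ≥0 × X ↦ markFlow W (x i) q.1 q.2) (s₀, ξ₀) := by
    intro i s₀ hs₀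
    have hfar' : ∀ s : ℝ≥0, s ≤ b' →
        ((⟨m / 2, by positivity⟩ : ℝ≥0) : ℝ) ≤ |Loewner.realFlowStop (Φ ξ₀) (x i) s| :=
      fun s hs ↦ by rw [← hWf]; exact (hmar i s hs).trans (le_abs_self _)
    have hb : ((b' : ℝ≥0) : WithTop ℝ≥0) < Loewner.swallowingTime (Φ ξ₀) (x i) := by
      refine Loewner.coe_lt_swallowingTime_of_realFlowStop_ne_zero fun h0 ↦ ?_
      have h1 := hmar i b' le_rfl
      rw [hWf, h0] at h1
      linarith
    have key : ContinuousAt ((fun q' : ℝ≥0 × C(ℝ≥0, ℝ) ↦ Loewner.realFlowStop q'.2 (x i) q'.1) ∘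
        fun q : ℝ≥0 × X ↦ (q.1, Φ q.2)) (s₀, ξ₀) :=
      ContinuousAt.comp_of_eq (Loewner.continuousAt_realFlowStop_driver (w₀ := Φ ξ₀) hb hm₀ hfar' hs₀)
        (continuousAt_fst.prodMk (hΦ.continuousAt.comp continuousAt_snd)) rfl
    refine key.congr_of_eventuallyEq (Eventually.of_forall fun q ↦ ?_)
    exact hWf (x i) q.1 q.2
  -- Step 3: uniform closeness of the coordinate paths on `[0, b]`
  have hunif0 : ∀ ε : ℝ, 0 < ε → ∀ᶠ ξ in 𝓝 ξ₀, ∀ s : ℝ≥0, s ≤ b → |Φ0 ξ s - Φ0 ξ₀ s| < ε :=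
    eventually_forall_abs_sub_lt_of_continuousAt hbb' (F := fun q ↦ markFlow W (x 0) q.1 q.2) (JF 0)
  have hunif1 : ∀ ε : ℝ, 0 < ε → ∀ᶠ ξ in 𝓝 ξ₀, ∀ s : ℝ≥0, s ≤ b → |Ψ1 ξ s - Ψ1 ξ₀ s| < ε :=
    eventually_forall_abs_sub_lt_of_continuousAt hbb'
      (F := fun q ↦ markFlow W (x 1) q.1 q.2 - markFlow W (x 0) q.1 q.2)
      (fun s hs ↦ (JF 1 s hs).sub (JF 0 s hs))
  have hunif2 : ∀ ε : ℝ, 0 < ε → ∀ᶠ ξ in 𝓝 ξ₀, ∀ s : ℝ≥0, s ≤ b → |Ψ2 ξ s - Ψ2 ξ₀ s| < ε :=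
    eventually_forall_abs_sub_lt_of_continuousAt hbb'
      (F := fun q ↦ markFlow W (x 2) q.1 q.2 - markFlow W (x 1) q.1 q.2)
      (fun s hs ↦ (JF 2 s hs).sub (JF 1 s hs))
  -- Step 4: lower semicontinuity of the level time, clean upper semicontinuity
  have hlsc : ∀ v : ℝ≥0, v ≤ b → (v : WithTop ℝ≥0) < min (τ0 ξ₀) (min (τ1 ξ₀) (τ2 ξ₀)) →
      ∀ᶠ ξ in 𝓝 ξ₀, (v : WithTop ℝ≥0) < min (τ0 ξ) (min (τ1 ξ) (τ2 ξ)) :=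
    lsc_min (τ₁ := τ0) (τ₂ := fun ξ ↦ min (τ1 ξ) (τ2 ξ)) (x₀ := ξ₀) (b := b)
      (lsc_exitTime_comp hunif0)
      (lsc_min (τ₁ := τ1) (τ₂ := τ2) (x₀ := ξ₀) (b := b) (lsc_exitTime_comp hunif1)
        (lsc_exitTime_comp hunif2))
  have husc : ∀ T : ℝ≥0, min (τ0 ξ₀) (min (τ1 ξ₀) (τ2 ξ₀)) = T → ∀ ε : ℝ, 0 < ε →
      ∃ s : ℝ≥0, (s : ℝ) < T + ε ∧ ∀ᶠ ξ in 𝓝 ξ₀, min (τ0 ξ) (min (τ1 ξ) (τ2 ξ)) ≤ s := by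
    intro T hT
    have hρT : ρ₀ = T := by rw [hρ₀, hlevel]; exact hT
    have hTb' : (T : WithTop ℝ≥0) < b := WithTop.coe_lt_coe.2 (hTb T hρT)
    by_cases h0 : τ0 ξ₀ ≤ min (τ1 ξ₀) (τ2 ξ₀)
    · have hτ0T : τ0 ξ₀ = T := by rw [← hT, min_eq_left h0]
      refine usc_min_left (τ₁ := τ0) (τ₂ := fun ξ ↦ min (τ1 ξ) (τ2 ξ)) (x₀ := ξ₀) h0
        (usc_exitTime_comp_of_clean hunif0
          (by show τ0 ξ₀ < (b : WithTop ℝ≥0); rw [hτ0T]; exact hTb') ?_) T hT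
      intro T' hT'
      have : T = T' := by
        have := hτ0T.symm.trans hT'; exact_mod_cast this
      subst this
      exact hclean₀ T hρT hT'
    · have h0' : min (τ1 ξ₀) (τ2 ξ₀) ≤ τ0 ξ₀ := (not_le.1 h0).le
      have hmin12 : min (τ1 ξ₀) (τ2 ξ₀) = T := by rw [← hT, min_eq_right h0']
      refine usc_min_right (τ₁ := τ0) (τ₂ := fun ξ ↦ min (τ1 ξ) (τ2 ξ)) (x₀ := ξ₀) h0' ?_ T hT
      by_cases h1 : τ1 ξ₀ ≤ τ2 ξ₀
      · have hτ1T : τ1 ξ₀ = T := by rw [← hmin12, min_eq_left h1]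
        refine usc_min_left (τ₁ := τ1) (τ₂ := τ2) (x₀ := ξ₀) h1
          (usc_exitTime_comp_of_clean hunif1
            (by show τ1 ξ₀ < (b : WithTop ℝ≥0); rw [hτ1T]; exact hTb') ?_)
        intro T' hT'
        have : T = T' := by
          have := hτ1T.symm.trans hT'; exact_mod_cast this
        subst this
        exact hclean₁ T hρT hT'
      · have h1' : τ2 ξ₀ ≤ τ1 ξ₀ := (not_le.1 h1).le
        have hτ2T : τ2 ξ₀ = T := by rw [← hmin12, min_eq_right h1']
        refine usc_min_right (τ₁ := τ1) (τ₂ := τ2) (x₀ := ξ₀) h1'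
          (usc_exitTime_comp_of_clean hunif2
            (by show τ2 ξ₀ < (b : WithTop ℝ≥0); rw [hτ2T]; exact hTb') ?_)
        intro T' hT'
        have : T = T' := by
          have := hτ2T.symm.trans hT'; exact_mod_cast this
        subst this
        exact hclean₂ T hρT hT'
  -- Step 5: joint continuity of the stopped clock
  have CL : ContinuousAt (fun q : ℝ≥0 × X ↦
      (min (q.1 : WithTop ℝ≥0) (min (τ0 q.2) (min (τ1 q.2) (τ2 q.2)))).untopA) (u₀, ξ₀) := by
    induction hρ : ρ₀ with
    | top =>
      have hu : u₀ < b := hub hρ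
      exact continuousAt_stoppedClock_of_lsc_usc (τ := fun ξ ↦ min (τ0 ξ) (min (τ1 ξ) (τ2 ξ)))
        (x₀ := ξ₀) hlsc husc hu
    | coe T =>
      have hT : min (τ0 ξ₀) (min (τ1 ξ₀) (τ2 ξ₀)) = T := by rw [← hlevel, ← hρ₀]; exact hρ
      exact continuousAt_stoppedClock_of_lsc_usc_of_lt (τ := fun ξ ↦ min (τ0 ξ) (min (τ1 ξ) (τ2 ξ)))
        (x₀ := ξ₀) hlsc husc hT (hTb T hρ) u₀
  -- Step 6: the value at the clock
  set c₀ : ℝ≥0 := (min (u₀ : WithTop ℝ≥0) ρ₀).untopA with hc₀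
  have hc₀ρ : (c₀ : WithTop ℝ≥0) ≤ ρ₀ := coe_untopA_min_le u₀ ρ₀
  have hc₀b' : c₀ < b' := by
    induction hρ : ρ₀ with
    | top =>
      have h1 : c₀ ≤ u₀ := untopA_min_coe_le u₀ ρ₀
      exact lt_of_le_of_lt h1 ((hub hρ).trans hbb')
    | coe T =>
      have h1 : c₀ ≤ T := by
        rw [← WithTop.coe_le_coe, ← hρ]; exact hc₀ρ
      exact lt_of_le_of_lt h1 ((hTb T hρ).trans hbb')
  have hCLc : ContinuousAt (fun q : ℝ≥0 × X ↦
      ((min (q.1 : WithTop ℝ≥0) (min (τ0 q.2) (min (τ1 q.2) (τ2 q.2)))).untopA, q.2)) (u₀, ξ₀) :=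
    CL.prodMk continuousAt_snd
  have GF : ∀ i, ContinuousAt (fun q : ℝ≥0 × X ↦ markFlow W (x i)
      (min (q.1 : WithTop ℝ≥0) (min (τ0 q.2) (min (τ1 q.2) (τ2 q.2)))).untopA q.2) (u₀, ξ₀) :=
    fun i ↦ ContinuousAt.comp_of_eq (JF i c₀ hc₀b') hCLc rfl
  obtain ⟨hpos0, h01, h12⟩ := marks_pos_pt (hc ξ₀) h hξ₀ hc₀ρ
  have hden : markFlow W (x 1) c₀ ξ₀ * (markFlow W (x 2) c₀ ξ₀ - markFlow W (x 0) c₀ ξ₀) ≠ 0 := by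
    have h1 : 0 < markFlow W (x 1) c₀ ξ₀ := hpos0.trans h01
    have h2 : 0 < markFlow W (x 2) c₀ ξ₀ - markFlow W (x 0) c₀ ξ₀ := by linarith
    positivity
  have hη : ContinuousAt (fun q : ℝ≥0 × X ↦ etaProc W x
      (min (q.1 : WithTop ℝ≥0) (min (τ0 q.2) (min (τ1 q.2) (τ2 q.2)))).untopA q.2) (u₀, ξ₀) := by
    simp only [etaProc, cardyEta]
    exact ((GF 0).mul ((GF 2).sub (GF 1))).div ((GF 1).mul ((GF 2).sub (GF 0))) hden
  exact hĝ.continuousAt.comp hη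

/-- **Joint continuity of the clipped crossing functional of the canonical process at a path
started at `0` with clean level exits** (`0 ≤ δ < min (x₀ - m) (M - x₀)`). [cite: CamiaNewman2007, §5] -/
theorem continuousAt_crossingObs_cutStart {ĝ : ℝ → ℝ} (hĝ : Continuous ĝ)
    (h : AdmissibleLevels x m M d) {δ : ℝ} (hδ0 : 0 ≤ δ) (hδm : δ < x 0 - m) (hδM : δ < M - x 0)
    {p₀ : C(ℝ≥0, ℝ)} (hp₀ : p₀ 0 = 0)
    (hclean₀ : ∀ T : ℝ≥0, levelTime (fun (w : C(ℝ≥0, ℝ)) (r : ℝ≥0) ↦ w r) x m M d p₀ = T →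
      exitTime (markFlow (fun (w : C(ℝ≥0, ℝ)) (r : ℝ≥0) ↦ w r) (x 0)) m M p₀ = T →
      ∀ ε : ℝ, 0 < ε → ∃ s : ℝ≥0, T < s ∧ (s : ℝ) < T + ε ∧
        markFlow (fun (w : C(ℝ≥0, ℝ)) (r : ℝ≥0) ↦ w r) (x 0) s p₀ ∉ Icc m M)
    (hclean₁ : ∀ T : ℝ≥0, levelTime (fun (w : C(ℝ≥0, ℝ)) (r : ℝ≥0) ↦ w r) x m M d p₀ = T →
      exitTime (fun t w ↦ markFlow (fun (w : C(ℝ≥0, ℝ)) (r : ℝ≥0) ↦ w r) (x 1) t w -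
        markFlow (fun (w : C(ℝ≥0, ℝ)) (r : ℝ≥0) ↦ w r) (x 0) t w) d (x 2 - x 0 + 1) p₀ = T →
      ∀ ε : ℝ, 0 < ε → ∃ s : ℝ≥0, T < s ∧ (s : ℝ) < T + ε ∧
        markFlow (fun (w : C(ℝ≥0, ℝ)) (r : ℝ≥0) ↦ w r) (x 1) s p₀ -
          markFlow (fun (w : C(ℝ≥0, ℝ)) (r : ℝ≥0) ↦ w r) (x 0) s p₀ ∉ Icc d (x 2 - x 0 + 1))
    (hclean₂ : ∀ T : ℝ≥0, levelTime (fun (w : C(ℝ≥0, ℝ)) (r : ℝ≥0) ↦ w r) x m M d p₀ = T →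
      exitTime (fun t w ↦ markFlow (fun (w : C(ℝ≥0, ℝ)) (r : ℝ≥0) ↦ w r) (x 2) t w -
        markFlow (fun (w : C(ℝ≥0, ℝ)) (r : ℝ≥0) ↦ w r) (x 1) t w) d (x 2 - x 0 + 1) p₀ = T →
      ∀ ε : ℝ, 0 < ε → ∃ s : ℝ≥0, T < s ∧ (s : ℝ) < T + ε ∧
        markFlow (fun (w : C(ℝ≥0, ℝ)) (r : ℝ≥0) ↦ w r) (x 2) s p₀ -
          markFlow (fun (w : C(ℝ≥0, ℝ)) (r : ℝ≥0) ↦ w r) (x 1) s p₀ ∉ Icc d (x 2 - x 0 + 1))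
    (u₀ : ℝ≥0) :
    ContinuousAt (fun q : ℝ≥0 × C(ℝ≥0, ℝ) ↦ crossingObs ĝ (fun (w : C(ℝ≥0, ℝ)) (r : ℝ≥0) ↦ w r)
      x m M d q.1 (q.2 - ContinuousMap.const ℝ≥0 (q.2 0 - max (-δ) (min (q.2 0) δ)))) (u₀, p₀) := by
  have hfix : p₀ - ContinuousMap.const ℝ≥0 (p₀ 0 - max (-δ) (min (p₀ 0) δ)) = p₀ :=
    cutStart_of_abs_le (by rw [hp₀, abs_zero]; exact hδ0)
  have hwin : p₀ 0 ∈ Ioo (x 0 - M) (x 0 - m) := by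
    rw [hp₀]
    constructor <;> linarith
  have hA := continuousAt_crossingObs_of_clean (W := fun (w : C(ℝ≥0, ℝ)) (r : ℝ≥0) ↦ w r)
    (Φ := id) continuous_id (fun _ ↦ rfl) hĝ h hwin hclean₀ hclean₁ hclean₂ u₀
  have hB : ContinuousAt (fun q : ℝ≥0 × C(ℝ≥0, ℝ) ↦
      (q.1, q.2 - ContinuousMap.const ℝ≥0 (q.2 0 - max (-δ) (min (q.2 0) δ)))) (u₀, p₀) :=
    continuousAt_fst.prodMk ((continuous_cutStart δ).continuousAt.comp continuousAt_snd)
  have key : ContinuousAt ((fun q : ℝ≥0 × C(ℝ≥0, ℝ) ↦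
      crossingObs ĝ (fun (w : C(ℝ≥0, ℝ)) (r : ℝ≥0) ↦ w r) x m M d q.1 q.2) ∘
      (fun q : ℝ≥0 × C(ℝ≥0, ℝ) ↦
        (q.1, q.2 - ContinuousMap.const ℝ≥0 (q.2 0 - max (-δ) (min (q.2 0) δ))))) (u₀, p₀) :=
    ContinuousAt.comp_of_eq hA hB (by rw [hfix])
  exact key

/-! ### Discrete paths not started near `0` form a vanishing event -/

section Start

variable [MeasurableSpace C(ℝ≥0, ℝ)] [BorelSpace C(ℝ≥0, ℝ)]
  {Ω : Type*} {mΩ : MeasurableSpace Ω} {μ : Measure Ω} [IsProbabilityMeasure μ]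
  {W : Ω → ℝ≥0 → ℝ}
  {Ω' : Type*} {mΩ' : MeasurableSpace Ω'} {P : Measure Ω'} [IsProbabilityMeasure P]
  {V : ℕ → ℝ≥0 → Ω' → ℝ}

/-- **Discrete paths not started in `(-δ, δ)` form a vanishing event.**  If continuous-path
processes `V k` converge in distribution on `C([0,∞), ℝ)` to a process `W` with `W 0 = 0`, then
`P(δ ≤ |V k 0|) → 0` for every `δ > 0` (the almost-continuous mapping theorem
`Process.tendsto_integral_comp_of_tendstoInDistribution_of_ae_continuousAt` for the indicator of
the closed set `{δ ≤ |w 0|}`, continuous at every path from `0`). [cite: Billingsley1999, Thm. 2.7] -/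
theorem tendsto_measureReal_le_abs_start (hWc : ∀ ω, Continuous (W ω)) (hW0 : ∀ ω, W ω 0 = 0)
    (hVc : ∀ k ω, Continuous (V k · ω))
    (hlaw : TendstoInDistribution (fun k ω ↦ (⟨fun u ↦ V k u ω, hVc k ω⟩ : C(ℝ≥0, ℝ))) atTop
      (fun ω ↦ (⟨fun u ↦ W ω u, hWc ω⟩ : C(ℝ≥0, ℝ))) (fun _ ↦ P) μ)
    (hVm : ∀ k, Measurable (V k 0)) {δ : ℝ} (hδ : 0 < δ) :
    Tendsto (fun k ↦ P.real {ω | δ ≤ |V k 0 ω|}) atTop (𝓝 0) := by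
  letI : PseudoMetricSpace C(ℝ≥0, ℝ) := TopologicalSpace.pseudoMetrizableSpacePseudoMetric _
  set F : Set C(ℝ≥0, ℝ) := {w | δ ≤ |w 0|} with hF
  have hFc : IsClosed F :=
    isClosed_le continuous_const (continuous_abs.comp (continuous_eval_const (0 : ℝ≥0)))
  set g : C(ℝ≥0, ℝ) → ℝ := F.indicator fun _ ↦ (1 : ℝ) with hg
  have hgm : Measurable g := measurable_const.indicator hFc.measurableSet
  have hgC : ∀ w, ‖g w‖ ≤ 1 := fun w ↦ by
    by_cases hw : w ∈ F
    · rw [hg, indicator_of_mem hw]; simp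
    · rw [hg, indicator_of_notMem hw]; simp
  have hnot : ∀ ω, (⟨fun u ↦ W ω u, hWc ω⟩ : C(ℝ≥0, ℝ)) ∉ F := fun ω ↦ by
    show ¬ (δ ≤ |W ω 0|)
    rw [hW0 ω, abs_zero]
    exact not_le.2 hδ
  have hcont : ∀ᵐ ω ∂μ, ContinuousAt g (⟨fun u ↦ W ω u, hWc ω⟩ : C(ℝ≥0, ℝ)) := by
    refine ae_of_all _ fun ω ↦ ?_
    have hev : g =ᶠ[𝓝 (⟨fun u ↦ W ω u, hWc ω⟩ : C(ℝ≥0, ℝ))] fun _ ↦ 0 := by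
      filter_upwards [hFc.isOpen_compl.mem_nhds (hnot ω)] with w hw
      exact indicator_of_notMem hw _
    exact hev.continuousAt
  haveI : ∀ k : ℕ, IsProbabilityMeasure ((fun _ : ℕ ↦ P) k) := fun _ ↦ by
    dsimp only; infer_instance
  have key := tendsto_integral_comp_of_tendstoInDistribution_of_ae_continuousAt hlaw hgm hgC hcont
  have hlim0 : ∫ ω, g (⟨fun u ↦ W ω u, hWc ω⟩ : C(ℝ≥0, ℝ)) ∂μ = 0 := by
    have : ∀ ω, g (⟨fun u ↦ W ω u, hWc ω⟩ : C(ℝ≥0, ℝ)) = 0 := fun ω ↦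
      indicator_of_notMem (hnot ω) _
    simp [this]
  rw [hlim0] at key
  refine key.congr fun k ↦ ?_
  have hS : MeasurableSet {ω | δ ≤ |V k 0 ω|} :=
    measurableSet_le measurable_const (continuous_abs.measurable.comp (hVm k))
  have hfun : (fun ω ↦ g (⟨fun u ↦ V k u ω, hVc k ω⟩ : C(ℝ≥0, ℝ))) =
      {ω | δ ≤ |V k 0 ω|}.indicator fun _ ↦ (1 : ℝ) := by
    funext ω
    by_cases hω : δ ≤ |V k 0 ω|
    · have h1 : (⟨fun u ↦ V k u ω, hVc k ω⟩ : C(ℝ≥0, ℝ)) ∈ F := hω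
      rw [hg, indicator_of_mem h1, indicator_of_mem (show ω ∈ {ω | δ ≤ |V k 0 ω|} from hω)]
    · have h1 : (⟨fun u ↦ V k u ω, hVc k ω⟩ : C(ℝ≥0, ℝ)) ∉ F := hω
      rw [hg, indicator_of_notMem h1, indicator_of_notMem (show ω ∉ {ω | δ ≤ |V k 0 ω|} from hω)]
  show ∫ ω, g (⟨fun u ↦ V k u ω, hVc k ω⟩ : C(ℝ≥0, ℝ)) ∂P = P.real {ω | δ ≤ |V k 0 ω|}
  rw [hfun, integral_indicator_const _ hS, smul_eq_mul, mul_one]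

end Start

end MartingaleOfData

open MartingaleOfData in
/-- **Registered form** (glue sub-goal `martingaleOfData_tendsto_measureReal_le_abs_start` of
stmt-CriticalPhenomena-0746): if continuous-path processes `V k` converge in distribution on
`C([0,∞), ℝ)` to a process started at `0`, the events `{δ ≤ |V k 0|}` have vanishing probability.
[cite: Billingsley1999, Thm. 2.7] -/
theorem martingaleOfData_tendsto_measureReal_le_abs_start : ∀ [MeasurableSpace C(ℝ≥0, ℝ)] [BorelSpace C(ℝ≥0, ℝ)] {Ω : Type*} {mΩ : MeasurableSpace Ω} {μ : MeasureTheory.Measure Ω} [MeasureTheory.IsProbabilityMeasure μ] {W : Ω → ℝ≥0 → ℝ} {Ω' : Type*} {mΩ' : MeasurableSpace Ω'} {P : MeasureTheory.Measure Ω'} [MeasureTheory.IsProbabilityMeasure P] {V : ℕ → ℝ≥0 → Ω' → ℝ} (hWc : ∀ ω, Continuous (W ω)), (∀ ω, W ω 0 = 0) → ∀ (hVc : ∀ k ω, Continuous (V k · ω)), MeasureTheory.TendstoInDistribution (fun k ω ↦ (⟨fun u ↦ V k u ω, hVc k ω⟩ : C(ℝ≥0, ℝ))) Filter.atTop (fun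 ω ↦ (⟨fun u ↦ W ω u, hWc ω⟩ : C(ℝ≥0, ℝ))) (fun _ ↦ P) μ → (∀ k, Measurable (V k 0)) → ∀ {δ : ℝ}, 0 < δ → Filter.Tendsto (fun k ↦ P.real {ω | δ ≤ |V k 0 ω|}) Filter.atTop (nhds 0) :=
  fun hWc hW0 hVc hlaw hVm _ hδ ↦ tendsto_measureReal_le_abs_start hWc hW0 hVc hlaw hVm hδ

end Summit.CriticalPhenomena.CardyFormulaZ2.Cruxes.CardyRigidity.CrossingMartingale

end
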